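import Summits.CriticalPhenomena.PercolationContinuityZ3.Theorems.Transplant.SubgraphStrictSetup
import HarnessLib

/-!
# The graph–subgraph strict inequality, II: `p_c(H) < p_c(H₀)` (endpoints of the segment and assembly)

builds on p205010 (kernel theorem, internal audit signed; external expert review pending) — nothing in this file uses p205010.
Lane `prim-bschramm`, seat `prim-bschramm-p4` gen 10 (PART C3, tier 2′ of `P4-GENERAL.md`).  Helper file
(`--supports stmt-CriticalPhenomena-4575 --as helper`).  Sequel of `SubgraphStrictSetup`.

THEOREM `SubStrict.Setup.criticalProb_lt`: for a `SubStrict.Setup H` (bounded-degree locally finite `H`, subgraph `H₀ = fromEdgeSet EH`,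
root, monotone exhaustion, and a route through an enhancement edge at every pivotal subgraph edge), **`p_c(H₀, o) < 1 ⟹ p_c(H, o) < p_c(H₀, o)`**.
Proof (Aizenman–Grimmett / Menshikov): the differential inequality of `SubgraphAGLine` with the local-modification property of
`SubgraphStrictSetup`, integrated along `(p₁, s₀) → (p₁ − κ s₀, 2 s₀)`, `s₀ = p_c(H₀)/4`, `p₁ ↓ p_c(H₀)`; endpoints
`Θ_n(p₁, 0) = P^{H₀}_{p₁}(exit Ω n) ≥ θ_{H₀}(p₁) > 0` and `Θ_n(q, q) = P^{H}_q(exit Ω n) ↓ ≤ θ_H(q)` (continuity from above).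
[cite: AizenmanGrimmett1991, Thm 1 (essential enhancements)] [cite: Menshikov1987, Thm (graph and subgraph)] [cite: MartineauSevero2019, §6]
-/

noncomputable section

namespace Summit.CriticalPhenomena.PercolationContinuityZ3.Theorems.Transplant

namespace SubStrict

open MeasureTheory SimpleGraph Literature.Probability.Percolation Literature.Probability.Percolation.ProdWeight
open Literature.Barriers.CriticalPhenomena (graphBall graphBall_finite mem_graphBall_self graphBall_mono)
open SubLoc
open scoped Classical

namespace Setup

variable {V : Type} {H : SimpleGraph V} [H.LocallyFinite] (S : Setup H)

/-! ## §4 The endpoints of the segment -/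

/-- **`Θ_n(p, 0) = P^{H₀}_p(exit)`** (the subgraph model). [cite: RussoZW1981, §4 Lemma 3 (proof)] -/
theorem theta_zero_eq (n : ℕ) (p : unitInterval) :
    SubAG.Theta (S.KE n) (S.KV n) (S.A n) p 0 = (bondPercolation S.H₀ p).real (S.A n) := by
  rw [SubAG.theta_zero_eq_cylPoly (S.H₀.edgeSet) (fun i hi => by
    rw [edgeSet_H₀, KE, Finset.mem_filter]
    have hi' : i ∈ S.K n := S.mem_KE_or_KV.2 ((@Finset.mem_union _ (_) _ _ _).1 hi)
    exact ⟨fun h => ⟨hi', h⟩, fun h => h.2⟩)]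
  refine (Russo.measureReal_eq_cylPoly ((S.determinedBy_A n).mono fun d hd => ?_) S.H₀.edgeSet p).symm
  exact Finset.mem_coe.2 ((@Finset.mem_union _ (_) _ _ _).2 (S.mem_KE_or_KV.1 (Finset.mem_coe.1 hd)))

/-- **`Θ_n(q, q) = P^{H}_q(exit)`** (the big graph at one density). [cite: RussoZW1981, §4 Lemma 3 (proof)] -/
theorem theta_diag_eq (n : ℕ) (q : unitInterval) :
    SubAG.Theta (S.KE n) (S.KV n) (S.A n) q q = (bondPercolation H q).real (S.A n) := by
  rw [SubAG.theta_diag_eq_cylPoly H.edgeSet (fun i hi =>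
    (S.mem_K.1 (S.mem_KE_or_KV.2 ((@Finset.mem_union _ (_) _ _ _).1 hi))).1)]
  refine (Russo.measureReal_eq_cylPoly ((S.determinedBy_A n).mono fun d hd => ?_) H.edgeSet q).symm
  exact Finset.mem_coe.2 ((@Finset.mem_union _ (_) _ _ _).2 (S.mem_KE_or_KV.1 (Finset.mem_coe.1 hd)))

/-- **`θ_{H₀}(o, p) ≤ P^{H₀}_p(exit from Ω n)`**: an infinite open cluster leaves every finite region. [folklore] -/
theorem theta_le_exit [Countable V] (n : ℕ) (p : unitInterval) : theta S.H₀ S.o p ≤ (bondPercolation S.H₀ p).real (S.A n) := by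
  rw [theta, measureReal_def, measureReal_def]
  refine ENNReal.toReal_mono (measure_ne_top _ _) (measure_mono_ae ?_)
  have hsub : ∀ᵐ ω ∂bondPercolation S.H₀ p, ω ⊆ S.H₀.edgeSet := ProbabilityTheory.setBernoulli_ae_subset
  filter_upwards [hsub] with ω hω hperc
  have hωH : ω ⊆ H.edgeSet := fun d hd => by
    have := hω hd; rw [edgeSet_H₀] at this; exact S.EH_sub this
  obtain ⟨v, hv, hvΩ⟩ := Set.Infinite.exists_notMem_finset hperc (S.Ω n)
  refine ⟨v, fun h => hvΩ h, ?_⟩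
  rw [og_eq_of_subset hωH]
  exact hv

/-- **Uniform exit probabilities force percolation**: if `P^H_q(exit from Ω n) ≥ η > 0` for all `n` then `θ_H(o, q) ≥ η`.
[cite: MartineauSevero2019, §4 (proof of Theorem 2.1, last step)] -/
theorem le_theta_of_exit [Countable V] (q : unitInterval) {η : ℝ} (h : ∀ n, η ≤ (bondPercolation H q).real (S.A n)) :
    η ≤ theta H S.o q := by
  set μ := bondPercolation H q with hμ
  have hiInter : μ (⋂ n, S.A n) = ⨅ n, μ (S.A n) :=
    S.A_antitone.measure_iInter (fun n => (S.measurableSet_A n).nullMeasurableSet) ⟨0, measure_ne_top _ _⟩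
  have hge : ENNReal.ofReal η ≤ μ (⋂ n, S.A n) := by
    rw [hiInter]
    refine le_iInf fun n => ?_
    rw [← ofReal_measureReal (measure_ne_top _ _)]
    exact ENNReal.ofReal_le_ofReal (h n)
  -- reaching out of every `Ω n` forces an infinite cluster (off a null set)
  have hle : μ (⋂ n, S.A n) ≤ μ (percolatesAt S.o) := by
    refine measure_mono_ae ?_
    have hsub : ∀ᵐ ω ∂μ, ω ⊆ H.edgeSet := ProbabilityTheory.setBernoulli_ae_subset
    filter_upwards [hsub] with ω hω hω'
    have hω'' : ω ∈ ⋂ n, S.A n := hω'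
    rw [Set.mem_iInter] at hω''
    by_contra hfin
    have hfin' : (openCluster ω S.o).Finite := Set.not_infinite.1 hfin
    choose nv hnv using S.Ω_exh
    obtain ⟨v, hvΩ, hv⟩ := hω'' (hfin'.toFinset.sup nv)
    rw [og_eq_of_subset hω] at hv
    have hvC : v ∈ hfin'.toFinset := hfin'.mem_toFinset.2 hv
    exact hvΩ (S.Ω_mono _ _ (Finset.le_sup (f := nv) hvC) (hnv v))
  have : η ≤ theta H S.o q := by
    rw [theta, ← hμ, measureReal_def, ← ENNReal.ofReal_le_iff_le_toReal (measure_ne_top _ _)]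
    exact hge.trans hle
  exact this

/-! ## §5 The strict inequality -/

/-- **THEOREM (graph–subgraph strict inequality).** For a setup `S` on the locally finite bounded-degree graph `H` — every pivotal
subgraph edge admits a route through an enhancement edge near it — if `p_c(H₀, o) < 1` then `p_c(H, o) < p_c(H₀, o)`.
[cite: AizenmanGrimmett1991, Thm 1 (essential enhancements)] [cite: Menshikov1987, Thm (graph and subgraph)] [cite: MartineauSevero2019, §6] -/
theorem criticalProb_lt [Countable V] (hlt : criticalProb S.H₀ S.o < 1) : criticalProb H S.o < criticalProb S.H₀ S.o := by
  set pc := criticalProb S.H₀ S.o with hpc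
  have hdeg : ∀ v, S.H₀.degree v ≤ S.Δ := fun v => (degree_le_of_le S.H₀_le).trans (S.degree_le v)
  have hpc0 : 0 < pc := criticalProb_pos_of_degree_le S.H₀ hdeg S.o
  -- constants
  set ν₀ : ℝ := min (pc / 4) ((1 - pc) / 2) with hν₀
  have hν₀0 : 0 < ν₀ := lt_min (by linarith) (by linarith)
  have hν₀1 : ν₀ ≤ 1 := (min_le_left _ _).trans (by linarith)
  have hν₀a : ν₀ ≤ pc / 4 := min_le_left _ _
  have hν₀b : ν₀ ≤ (1 - pc) / 2 := min_le_right _ _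
  set C : ℝ := SubAG.AGconst S.N S.N ν₀ with hC
  have hC0 : 0 ≤ C := SubAG.AGconst_nonneg _ _ hν₀0.le
  set s₀ : ℝ := pc / 4 with hs₀
  set κ : ℝ := min (1 / (C + 1)) 2 with hκ
  have hκ0 : 0 < κ := lt_min (by positivity) (by norm_num)
  have hκC : κ * C ≤ 1 := by
    have h1 : κ ≤ 1 / (C + 1) := min_le_left _ _
    calc κ * C ≤ 1 / (C + 1) * C := mul_le_mul_of_nonneg_right h1 hC0
      _ ≤ 1 := by rw [div_mul_eq_mul_div, one_mul, div_le_one (by linarith)]; linarith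
  set δ : ℝ := κ * s₀ with hδ
  have hδ0 : 0 < δ := mul_pos hκ0 (by positivity)
  have hδ1 : δ ≤ pc / 2 := by
    have h2 : κ ≤ 2 := min_le_right _ _
    calc δ = κ * (pc / 4) := rfl
      _ ≤ 2 * (pc / 4) := mul_le_mul_of_nonneg_right h2 (by linarith)
      _ = pc / 2 := by ring
  set p₁ : ℝ := min (pc + δ / 2) ((pc + 1) / 2) with hp₁
  have hp₁pc : pc < p₁ := lt_min (by linarith) (by linarith)
  have hp₁1 : p₁ ≤ 1 - ν₀ := (min_le_right _ _).trans (by linarith)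
  have hp₁δ : p₁ - δ < pc := by have := min_le_left (pc + δ / 2) ((pc + 1) / 2); linarith
  have hp₁0 : 0 ≤ p₁ := by linarith
  have hp₁le : p₁ ≤ 1 := by linarith
  set p₁I : unitInterval := ⟨p₁, hp₁0, hp₁le⟩
  have hη : 0 < theta S.H₀ S.o p₁I := theta_pos_of_criticalProb_lt_holds S.H₀ S.o p₁I (by exact hp₁pc)
  set η := theta S.H₀ S.o p₁I with hηdef
  set q : ℝ := max (p₁ - δ) (2 * s₀) with hq
  have hq0 : 0 ≤ q := (show (0:ℝ) ≤ 2 * s₀ by positivity).trans (le_max_right _ _)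
  have hqpc : q < pc := max_lt hp₁δ (by rw [hs₀]; linarith)
  have hq1 : q ≤ 1 := by linarith [(criticalProb_mem_Icc S.H₀ S.o).2]
  set qI : unitInterval := ⟨q, hq0, hq1⟩
  -- the chain of inequalities at every stage
  have hchain : ∀ n, η ≤ (bondPercolation H qI).real (S.A n) := by
    intro n
    have hA : IsUpperSet (S.A n) := isUpperSet_exitEv _ _
    have hd := S.disjoint_KE_KV n
    have h1 : η ≤ SubAG.Theta (S.KE n) (S.KV n) (S.A n) p₁ 0 := by
      rw [show (p₁ : ℝ) = (p₁I : ℝ) from rfl, S.theta_zero_eq n p₁I]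
      exact S.theta_le_exit n p₁I
    have h2 : SubAG.Theta (S.KE n) (S.KV n) (S.A n) p₁ 0 ≤ SubAG.Theta (S.KE n) (S.KV n) (S.A n) p₁ s₀ :=
      SubAG.theta_mono_s hA hd hp₁0 hp₁le le_rfl (by positivity) (by linarith)
    have h3 : SubAG.Theta (S.KE n) (S.KV n) (S.A n) p₁ s₀ ≤ SubAG.Theta (S.KE n) (S.KV n) (S.A n) (p₁ - δ) (2 * s₀) := by
      have h := SubAG.theta_seg_mono (KE := S.KE n) (KV := S.KV n) (A := S.A n) hA hd (S.locMod n) (N := S.N) (NM := S.N)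
        (fun e he => S.card_W_le n (S.mem_K.1 (Finset.mem_filter.1 he).1).1)
        (fun f hf => S.card_filter_W_le n f (S.mem_K.1 (Finset.mem_filter.1 hf).1).1 _ fun e he => (@Finset.mem_filter _ _ (_) _ _).1 he)
        (p₀ := p₁ + κ * s₀) (κ := κ) (t₀ := s₀) (t₁ := 2 * s₀) hν₀0 hν₀1 hκ0.le hκC
        (by linarith) (by linarith) (by linarith) (by linarith) (by linarith)
      have e1 : p₁ + κ * s₀ - κ * s₀ = p₁ := by ring
      have e2 : p₁ + κ * s₀ - κ * (2 * s₀) = p₁ - δ := by rw [hδ]; ring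
      rw [e1, e2] at h
      exact h
    have h4 : SubAG.Theta (S.KE n) (S.KV n) (S.A n) (p₁ - δ) (2 * s₀) ≤ SubAG.Theta (S.KE n) (S.KV n) (S.A n) q (2 * s₀) :=
      SubAG.theta_mono_p hA hd (by linarith) (le_max_left _ _) hq1 (by positivity) (by linarith)
    have h5 : SubAG.Theta (S.KE n) (S.KV n) (S.A n) q (2 * s₀) ≤ SubAG.Theta (S.KE n) (S.KV n) (S.A n) q q :=
      SubAG.theta_mono_s hA hd hq0 hq1 (by positivity) (le_max_right _ _) hq1
    have h6 : SubAG.Theta (S.KE n) (S.KV n) (S.A n) q q = (bondPercolation H qI).real (S.A n) := S.theta_diag_eq n qI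
    linarith
  have hθ : 0 < theta H S.o qI := hη.trans_le (S.le_theta_of_exit qI hchain)
  exact (OrbitQuotient.criticalProb_le_of_theta_pos H S.o qI hθ).trans_lt hqpc

end Setup

end SubStrict

end Summit.CriticalPhenomena.PercolationContinuityZ3.Theorems.Transplant

end
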